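import Literature.AlgebraicTopology.SingularHomology.PuncturedEuclidean
import Literature.AlgebraicTopology.SingularHomology.MayerVietorisExactness
import Literature.AlgebraicTopology.SingularHomology.ExcisionTheorem
import Literature.AlgebraicTopology.SingularHomology.DisjointUnion
import Literature.AlgebraicTopology.SingularHomology.Orientation
import Mathlib.Topology.Homotopy.Path
import HarnessLib

/-!
# A reflection is not the identity on `Hₘ(ℝᵐ⁺¹ ∖ 0; ℤ)` and on `Hₙ(ℝⁿ | 0; ℤ)`

A. Hatcher, *Algebraic Topology* (2002), §2.2, property (e) of the degree (p. 134): a reflection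
of `Sⁿ` has degree `-1`; §3.3, p. 233: "a reflection takes a generator `α` of
`Hₙ(ℝⁿ, ℝⁿ - {x})` to `-α`" (also §2.2 Exercise 7). This is the one genuinely homological input
of the comparison between smooth and homological orientations
(`Literature.Topology.FourManifolds.isOrientable_iff_isOrientableOver_int`); the tree's sphere
computations (`…SphereHomology`, `…LocalHomologyIso`) give the groups but no induced map of a
reflection. We prove it for Mathlib's singular homology with `ℤ` coefficients, in the model
`ℝⁿ ∖ {0} ≃ Sⁿ⁻¹` of `…PuncturedEuclidean` (`punctured n ⊆ RVec n = (Fin n → ℝ)`):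

* **degree zero** (`ptClass`, `ptGen`, the two-point lemma `map_ptClass_sub_ne_self`): if
  `r : W → W` swaps two points `p`, `q` separated by a continuous map `W → pt ⊔ pt`, then `r_*`
  does not fix `β₀ = [p] - [q] ∈ H₀(W; ℤ)` (it negates it, and `β₀ + β₀ ≠ 0` by the augmentation
  and the additivity `singularHomology.map_inl_add_map_inr_eq_zero_iff` of `…DisjointUnion`);
* `negCoord i` / `reflPunctured i` — the reflection of `ℝⁿ` / `ℝⁿ ∖ {0}` in the `i`-th coordinate;
* the **Mayer–Vietoris step** `map_reflPunctured_eq_id_of_succ`: for the slit decomposition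
  `ℝᵏ⁺¹ ∖ 0 = A ∪ B` of `…PuncturedEuclidean` (contractible pieces, `A ∩ B ≃ₕ ℝᵏ ∖ 0` by
  forgetting the last coordinate) a reflection in a non-last coordinate preserves `A` and `B`,
  the connecting map `δ : Hₘ₊₁(ℝᵏ⁺¹ ∖ 0) → Hₘ(A ∩ B)` is natural
  (`mayerVietoris.δ_naturality_holds`)
  and onto for `m ≥ 1` (`mayerVietoris.exact₃_holds`), so "reflection `= 𝟙` on `Hₘ₊₁(ℝᵏ⁺¹ ∖ 0)`"
  descends to "reflection `= 𝟙` on `Hₘ(ℝᵏ ∖ 0)`";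
* the **base case** `map_reflPunctured_one_ne_id` (`H₁(ℝ² ∖ 0)`): by exactness `δ` hits
  `β₀ = [(1,0)] - [(-1,0)] ∈ H₀(A ∩ B)`, to which the two-point lemma applies; hence
  **`map_reflPunctured_zero_ne_id`**: the reflection in the first coordinate is not the identity
  on `Hₘ₊₁(ℝᵐ⁺² ∖ 0; ℤ)` for every `m`;
* **`localHomology_map_reflEuclidean_ne_id`**: the reflection `reflEuclidean n` of
  `EuclideanSpace ℝ (Fin (n + 1))` in the first coordinate is not the identity on the local
  homology `Hₙ₊₁(ℝⁿ⁺¹ | 0; ℤ) = Hₙ₊₁(ℝⁿ⁺¹, ℝⁿ⁺¹ ∖ 0; ℤ)` (`…Orientation`), through the natural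
  connecting map of the pair, onto `Hₙ(ℝⁿ⁺¹ ∖ 0)` for `n ≥ 1` (`ℝⁿ⁺¹` contractible); for `n = 0`
  the two-point lemma is applied to `H₀(ℝ ∖ 0)` directly.

Since these groups are `≅ ℤ`, "not the identity" is equivalent to "acts by `-1`"; the sign form
is derived where needed (`…LinearLocalDegree`). Coefficients are `ℤ` on purpose (over a ring of
characteristic `2` reflections act trivially). Everything is proved; no named facts.

## References

* A. Hatcher, *Algebraic Topology*, CUP 2002, §2.1 Prop. 2.6–2.8 (degree zero, additivity),
  §2.2 property (e) p. 134 and pp. 149–150 (Mayer–Vietoris), Exercise 7 p. 155, §3.3 p. 233.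
  [HatcherAT2002]
-/

noncomputable section

open CategoryTheory Limits Set

universe u

namespace Literature.AlgebraicTopology.SingularHomology

/-! ### Point classes in `H₀` and the two-point lemma -/

section PointClasses

variable {W Y : Type u} [TopologicalSpace W] [TopologicalSpace Y]


/-- The constant map from the one-point space at `w` (the singular `0`-simplex at `w`,
Hatcher 2002, §2.1). [folklore] -/
abbrev ptMap (w : W) : C(PUnit.{u + 1}, W) := ContinuousMap.const _ w

/-- The class of the point `w` with coefficient `g ∈ H₀(pt; ℤ)`: `(c_w)_* g ∈ H₀(W; ℤ)`
(Hatcher 2002, §2.1, Prop. 2.6–2.7: `H₀` is generated by point classes). [folklore] -/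
def ptClass (g : singularHomology ℤ ℤ PUnit.{u + 1} 0) (w : W) : singularHomology ℤ ℤ W 0 :=
  singularHomology.map ℤ ℤ (ptMap w) 0 g

/-- Naturality of point classes: `f_* [w] = [f w]`. [folklore] -/
theorem map_ptClass (f : C(W, Y)) (g : singularHomology ℤ ℤ PUnit.{u + 1} 0) (w : W) :
    singularHomology.map ℤ ℤ f 0 (ptClass g w) = ptClass g (f w) := by
  rw [ptClass, ptClass, ← ModuleCat.comp_apply, ← singularHomology.map_comp]
  rfl

/-- Points in the same path component have the same class (homotopy invariance, Hatcher 2002,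
Prop. 2.7 and Thm. 2.10). [folklore] -/
theorem ptClass_eq_of_joined (g : singularHomology ℤ ℤ PUnit.{u + 1} 0) {p q : W}
    (h : Joined p q) : ptClass g p = ptClass g q := by
  obtain ⟨γ⟩ := h
  have : (ptMap p : C(PUnit.{u + 1}, W)).Homotopic (ptMap q) := ⟨γ.toHomotopyConst⟩
  rw [ptClass, ptClass, singularHomology.map_eq_of_homotopic ℤ ℤ this]

/-- The generator of `H₀(pt; ℤ)`: the preimage of `1` under the augmentation isomorphism
`ε : H₀(pt; ℤ) ≅ ℤ` (Hatcher 2002, Prop. 2.7–2.8). [folklore] -/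
def ptGen : singularHomology ℤ ℤ PUnit.{u + 1} 0 :=
  haveI := singularHomology.isIso_ε_of_pathConnectedSpace ℤ ℤ (X := PUnit.{u + 1})
  inv (singularHomology.ε ℤ ℤ PUnit.{u + 1}) (ULift.up 1)

/-- `ε ptGen = 1`. [folklore] -/
theorem ε_ptGen :
    singularHomology.ε ℤ ℤ PUnit.{u + 1} ptGen = ULift.up 1 := by
  haveI := singularHomology.isIso_ε_of_pathConnectedSpace ℤ ℤ (X := PUnit.{u + 1})
  rw [ptGen, ← ModuleCat.comp_apply, IsIso.inv_hom_id, ModuleCat.id_apply]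

/-- `H₀(pt; ℤ)` has no `2`-torsion at `ptGen`: `ptGen + ptGen ≠ 0` (apply `ε`). [folklore] -/
theorem ptGen_add_ptGen_ne_zero : (ptGen : singularHomology ℤ ℤ PUnit.{u + 1} 0) + ptGen ≠ 0 := by
  intro h
  have := congrArg (singularHomology.ε ℤ ℤ PUnit.{u + 1}) h
  rw [map_add, ε_ptGen, map_zero] at this
  have h2 : ((ULift.up (1 : ℤ) : ULift.{u} ℤ) + ULift.up (1 : ℤ)).down = 0 := by rw [this]; rfl
  simp at h2

/-- In the two-point space `pt ⊔ pt`, `β = [inl] - [inr]` satisfies `β + β ≠ 0` (additivity of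
`H₀`, Hatcher 2002, Prop. 2.6; here `singularHomology.map_inl_add_map_inr_eq_zero_iff`).
[folklore] -/
theorem ptClass_inl_sub_inr_add_self_ne_zero :
    (ptClass ptGen (Sum.inl PUnit.unit : PUnit.{u + 1} ⊕ PUnit.{u + 1}) -
      ptClass ptGen (Sum.inr PUnit.unit)) +
    (ptClass ptGen (Sum.inl PUnit.unit : PUnit.{u + 1} ⊕ PUnit.{u + 1}) -
      ptClass ptGen (Sum.inr PUnit.unit)) ≠ 0 := by
  intro h
  have hl : ptClass ptGen (Sum.inl PUnit.unit : PUnit.{u + 1} ⊕ PUnit.{u + 1}) =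
      singularHomology.map ℤ ℤ (SingularSimplex.sumInl PUnit.{u + 1} PUnit.{u + 1}) 0 ptGen := by
    rw [ptClass]; congr 1
  have hr : ptClass ptGen (Sum.inr PUnit.unit : PUnit.{u + 1} ⊕ PUnit.{u + 1}) =
      singularHomology.map ℤ ℤ (SingularSimplex.sumInr PUnit.{u + 1} PUnit.{u + 1}) 0 ptGen := by
    rw [ptClass]; congr 1
  have e : (ptClass ptGen (Sum.inl PUnit.unit : PUnit.{u + 1} ⊕ PUnit.{u + 1}) -
      ptClass ptGen (Sum.inr PUnit.unit)) +
    (ptClass ptGen (Sum.inl PUnit.unit : PUnit.{u + 1} ⊕ PUnit.{u + 1}) -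
      ptClass ptGen (Sum.inr PUnit.unit)) =
      singularHomology.map ℤ ℤ (SingularSimplex.sumInl PUnit.{u + 1} PUnit.{u + 1}) 0
        (ptGen + ptGen) +
      singularHomology.map ℤ ℤ (SingularSimplex.sumInr PUnit.{u + 1} PUnit.{u + 1}) 0
        (-(ptGen + ptGen)) := by
    rw [hl, hr, map_add, map_neg, map_add]; abel
  rw [e] at h
  have := (singularHomology.map_inl_add_map_inr_eq_zero_iff 0 _ _).1 h
  exact ptGen_add_ptGen_ne_zero this.1

/-- **Two-point lemma.** Let `r : W → W` swap two points `p`, `q` which are separated by a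
continuous map `s : W → pt ⊔ pt`. Then `β₀ = [p] - [q] ∈ H₀(W; ℤ)` is not fixed by `r_*`
(indeed `r_* β₀ = -β₀` while `β₀ + β₀ ≠ 0`, as one sees after applying `s_*`). This is the
degree-zero form of "a reflection has degree `-1`" (Hatcher 2002, §2.2 property (e), p. 134,
for `S⁰`). [folklore] -/
theorem map_ptClass_sub_ne_self (r : C(W, W)) {p q : W} (hp : r p = q) (hq : r q = p)
    (s : C(W, PUnit.{u + 1} ⊕ PUnit.{u + 1})) (hsp : s p = Sum.inl PUnit.unit)
    (hsq : s q = Sum.inr PUnit.unit) :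
    singularHomology.map ℤ ℤ r 0 (ptClass ptGen p - ptClass ptGen q) ≠
      ptClass ptGen p - ptClass ptGen q := by
  intro h
  rw [map_sub, map_ptClass, map_ptClass, hp, hq] at h
  -- `[q] - [p] = [p] - [q]` ⇒ `([p] - [q]) + ([p] - [q]) = 0` ⇒ same after `s_*`
  have h2 : (ptClass ptGen p - ptClass ptGen q) + (ptClass ptGen p - ptClass ptGen q) = 0 := by
    nth_rw 2 [← h]; abel
  have h3 := congrArg (singularHomology.map ℤ ℤ s 0) h2
  rw [map_add, map_sub, map_ptClass, map_ptClass, hsp, hsq, map_zero] at h3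
  exact ptClass_inl_sub_inr_add_self_ne_zero h3

/-- The class `[p] - [q]` dies under any map `i` for which `i p` and `i q` are joined by a path
(Hatcher 2002, Prop. 2.7). [folklore] -/
theorem map_ptClass_sub_eq_zero (i : C(W, Y)) {p q : W} (h : Joined (i p) (i q)) :
    singularHomology.map ℤ ℤ i 0 (ptClass ptGen p - ptClass ptGen q) = 0 := by
  rw [map_sub, map_ptClass, map_ptClass, ptClass_eq_of_joined _ h, sub_self]


end PointClasses

/-! ### Coordinate reflections of `ℝⁿ` and of `ℝⁿ ∖ {0}` -/

section Reflection

variable {n : ℕ}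

/-- The reflection of `ℝⁿ = (Fin n → ℝ)` in the `i`-th coordinate hyperplane: negate the `i`-th
coordinate (Hatcher 2002, §2.2 property (e), p. 134). [folklore] -/
def negCoord (i : Fin n) : C(RVec n, RVec n) where
  toFun v := fun j => if j = i then -v j else v j
  continuous_toFun := by
    refine continuous_pi fun j => ?_
    by_cases h : j = i
    · simp only [h, if_true]; exact (continuous_apply i).neg
    · simp only [h, if_false]; exact continuous_apply j

/-- The reflection on coordinates. [folklore] -/
@[simp] lemma negCoord_apply (i : Fin n) (v : RVec n) (j : Fin n) :
    negCoord i v j = if j = i then -v j else v j := rfl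

/-- Reflecting twice is the identity. [folklore] -/
@[simp] lemma negCoord_negCoord (i : Fin n) (v : RVec n) : negCoord i (negCoord i v) = v := by
  ext j; by_cases h : j = i <;> simp [h]

/-- The reflection fixes the origin. [folklore] -/
@[simp] lemma negCoord_zero (i : Fin n) : negCoord i (0 : RVec n) = 0 := by
  ext j; simp

/-- Only the origin is reflected to the origin. [folklore] -/
lemma negCoord_eq_zero_iff (i : Fin n) (v : RVec n) : negCoord i v = 0 ↔ v = 0 := by
  refine ⟨fun h => ?_, fun h => by rw [h, negCoord_zero]⟩
  rw [← negCoord_negCoord i v, h, negCoord_zero]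

/-- Forgetting the last coordinate intertwines the reflections in the `j`-th coordinate of
`ℝᵏ⁺¹` and of `ℝᵏ` (`j < k`). [folklore] -/
lemma init_negCoord_castSucc {k : ℕ} (j : Fin k) (v : RVec (k + 1)) :
    Fin.init (negCoord (Fin.castSucc j) v) = negCoord j (Fin.init v) := by
  ext i
  simp only [Fin.init, negCoord_apply, Fin.castSucc_inj]

/-- Reflecting in a non-last coordinate does not change the last coordinate. [folklore] -/
lemma negCoord_castSucc_apply_last {k : ℕ} (j : Fin k) (v : RVec (k + 1)) :
    negCoord (Fin.castSucc j) v (Fin.last k) = v (Fin.last k) := by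
  rw [negCoord_apply, if_neg (Fin.castSucc_lt_last j).ne']

/-- The reflection of the punctured space `ℝⁿ ∖ {0}` in the `i`-th coordinate (Hatcher 2002,
§2.2 property (e), in the model `ℝⁿ ∖ 0 ≃ Sⁿ⁻¹`). [folklore] -/
def reflPunctured (i : Fin n) : C(↥(punctured n), ↥(punctured n)) where
  toFun v := ⟨negCoord i v.1, fun h => v.2 ((negCoord_eq_zero_iff i v.1).1 h)⟩
  continuous_toFun := ((negCoord i).continuous.comp continuous_subtype_val).subtype_mk _

/-- The reflection of `ℝⁿ ∖ {0}` on coordinates. [folklore] -/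
@[simp] lemma reflPunctured_apply_coe (i : Fin n) (v : ↥(punctured n)) :
    (reflPunctured i v : RVec n) = negCoord i v.1 := rfl

end Reflection

/-! ### The Mayer–Vietoris step along the slit decomposition -/

section MVStep

variable (k : ℕ)

/-- The slit piece `A = slitUp k` as a subset of the subtype `ℝᵏ⁺¹ ∖ {0}`. [folklore] -/
def slitU : Set ↥(punctured (k + 1)) := Subtype.val ⁻¹' slitUp k

/-- The slit piece `B = slitDown k` as a subset of the subtype `ℝᵏ⁺¹ ∖ {0}`. [folklore] -/
def slitV : Set ↥(punctured (k + 1)) := Subtype.val ⁻¹' slitDown k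

/-- `A` is open in `ℝᵏ⁺¹ ∖ {0}`. [folklore] -/
lemma isOpen_slitU : IsOpen (slitU k) := (isOpen_slitUp k).preimage continuous_subtype_val

/-- `B` is open in `ℝᵏ⁺¹ ∖ {0}`. [folklore] -/
lemma isOpen_slitV : IsOpen (slitV k) := (isOpen_slitDown k).preimage continuous_subtype_val

/-- The interiors of `A` and `B` cover `ℝᵏ⁺¹ ∖ {0}` (both are open and `A ∪ B = ℝᵏ⁺¹ ∖ 0`).
[folklore] -/
lemma interior_slitU_union_interior_slitV : interior (slitU k) ∪ interior (slitV k) = univ := by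
  rw [(isOpen_slitU k).interior_eq, (isOpen_slitV k).interior_eq, eq_univ_iff_forall]
  intro v
  have hv : v.1 ∈ slitUp k ∪ slitDown k := by rw [slitUp_union_slitDown]; exact v.2
  exact hv

/-- `slitU ≃ₜ A` (the same set seen in `ℝᵏ⁺¹ ∖ 0` and in `ℝᵏ⁺¹`). [folklore] -/
def slitUHomeomorph : ↥(slitU k) ≃ₜ ↥(slitUp k) where
  toFun v := ⟨v.1.1, v.2⟩
  invFun w := ⟨⟨w.1, by
    have : w.1 ∈ slitUp k ∪ slitDown k := Or.inl w.2
    rwa [slitUp_union_slitDown] at this⟩, w.2⟩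
  left_inv _ := rfl
  right_inv _ := rfl
  continuous_toFun := by fun_prop
  continuous_invFun := by fun_prop

/-- `slitV ≃ₜ B`. [folklore] -/
def slitVHomeomorph : ↥(slitV k) ≃ₜ ↥(slitDown k) where
  toFun v := ⟨v.1.1, v.2⟩
  invFun w := ⟨⟨w.1, by
    have : w.1 ∈ slitUp k ∪ slitDown k := Or.inr w.2
    rwa [slitUp_union_slitDown] at this⟩, w.2⟩
  left_inv _ := rfl
  right_inv _ := rfl
  continuous_toFun := by fun_prop
  continuous_invFun := by fun_prop

/-- `slitU ∩ slitV ≃ₜ A ∩ B`. [folklore] -/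
def slitUVHomeomorph : ↥(slitU k ∩ slitV k) ≃ₜ ↥(slitUp k ∩ slitDown k) where
  toFun v := ⟨v.1.1, v.2⟩
  invFun w := ⟨⟨w.1, by
    have : w.1 ∈ slitUp k ∪ slitDown k := Or.inl w.2.1
    rwa [slitUp_union_slitDown] at this⟩, w.2⟩
  left_inv _ := rfl
  right_inv _ := rfl
  continuous_toFun := by fun_prop
  continuous_invFun := by fun_prop

/-- `A` is contractible (`contractibleSpace_slitUp` transported). [folklore] -/
instance contractibleSpace_slitU : ContractibleSpace ↥(slitU k) :=
  haveI := contractibleSpace_slitUp k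
  (slitUHomeomorph k).contractibleSpace

/-- `B` is contractible (`contractibleSpace_slitDown` transported). [folklore] -/
instance contractibleSpace_slitV : ContractibleSpace ↥(slitV k) :=
  haveI := contractibleSpace_slitDown k
  (slitVHomeomorph k).contractibleSpace

/-- The Mayer–Vietoris connecting map `δ : Hₘ₊₁(ℝᵏ⁺¹ ∖ 0; ℤ) → Hₘ(A ∩ B; ℤ)` of the slit
decomposition (Hatcher 2002, §2.2, pp. 149–150; excision for the subtype is the proved
`relativeSingularHomology.isIso_map_of_interior_union_interior_holds`).
[cite: HatcherAT2002, §2.2 pp. 149–150] -/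
abbrev slitδ (m : ℕ) : singularHomology ℤ ℤ ↥(punctured (k + 1)) (m + 1) ⟶
    singularHomology ℤ ℤ ↥(slitU k ∩ slitV k) m :=
  mayerVietoris.δ ℤ ℤ (slitU k) (slitV k)
    (relativeSingularHomology.isIso_map_of_interior_union_interior_holds ℤ ℤ _)
    (interior_slitU_union_interior_slitV k) m

/-- In positive degrees `δ` is surjective: the next term `Hₘ(A) ⊕ Hₘ(B)` of the Mayer–Vietoris
sequence vanishes as `A`, `B` are contractible (Hatcher 2002, §2.2, p. 149). [folklore] -/
theorem slitδ_surjective (m : ℕ) (hm : m ≠ 0) : Function.Surjective (slitδ k m) := by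
  intro β
  have hex := mayerVietoris.exact₃_holds ℤ ℤ (slitU k) (slitV k)
    (relativeSingularHomology.isIso_map_of_interior_union_interior_holds ℤ ℤ _)
    (interior_slitU_union_interior_slitV k) m
  rw [ShortComplex.moduleCat_exact_iff] at hex
  have hZ : IsZero (singularHomology ℤ ℤ ↥(slitU k) m ⊞ singularHomology ℤ ℤ ↥(slitV k) m) :=
    (biprod_isZero_iff _ _).2 ⟨isZero_singularHomology_of_contractibleSpace ℤ ℤ hm,
      isZero_singularHomology_of_contractibleSpace ℤ ℤ hm⟩
  haveI := ModuleCat.subsingleton_of_isZero hZ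
  obtain ⟨α, hα⟩ := hex β (Subsingleton.elim _ _)
  exact ⟨α, hα⟩

variable {k}

/-- The reflection in a non-last coordinate preserves the slit piece `A`. [folklore] -/
lemma mapsTo_reflPunctured_slitU (j : Fin k) :
    MapsTo (reflPunctured (Fin.castSucc j)) (slitU k) (slitU k) := by
  intro v hv
  change negCoord (Fin.castSucc j) v.1 ∈ slitUp k
  simp only [slitUp, mem_setOf_eq, init_negCoord_castSucc, ne_eq, negCoord_eq_zero_iff,
    negCoord_castSucc_apply_last]
  exact hv

/-- The reflection in a non-last coordinate preserves the slit piece `B`. [folklore] -/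
lemma mapsTo_reflPunctured_slitV (j : Fin k) :
    MapsTo (reflPunctured (Fin.castSucc j)) (slitV k) (slitV k) := by
  intro v hv
  change negCoord (Fin.castSucc j) v.1 ∈ slitDown k
  simp only [slitDown, mem_setOf_eq, init_negCoord_castSucc, ne_eq, negCoord_eq_zero_iff,
    negCoord_castSucc_apply_last]
  exact hv

/-- The reflection restricted to `A ∩ B`. [folklore] -/
abbrev reflSlitUV (j : Fin k) : C(↥(slitU k ∩ slitV k), ↥(slitU k ∩ slitV k)) :=
  subsetRestrict (reflPunctured (Fin.castSucc j))
    ((mapsTo_reflPunctured_slitU j).inter_inter (mapsTo_reflPunctured_slitV j))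

/-- The projection `A ∩ B → ℝᵏ ∖ 0` (forget the last coordinate), a homotopy equivalence
(`slitInterHomotopyEquiv`). [folklore] -/
abbrev slitUVProj (k : ℕ) : C(↥(slitU k ∩ slitV k), ↥(punctured k)) :=
  (slitInterProj k).comp (slitUVHomeomorph k : C(↥(slitU k ∩ slitV k), ↥(slitUp k ∩ slitDown k)))

/-- The projection intertwines the reflections in the `j`-th coordinate. [folklore] -/
lemma slitUVProj_comp_reflSlitUV (j : Fin k) :
    (slitUVProj k).comp (reflSlitUV j) = (reflPunctured j).comp (slitUVProj k) := by
  ext v : 1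
  apply Subtype.ext
  exact init_negCoord_castSucc j v.1.1

/-- The projection `A ∩ B → ℝᵏ ∖ 0` is an isomorphism on homology (homeomorphism followed by the
homotopy equivalence `slitInterHomotopyEquiv`; Hatcher 2002, Cor. 2.11). [folklore] -/
instance isIso_map_slitUVProj (m : ℕ) : IsIso (singularHomology.map ℤ ℤ (slitUVProj k) m) := by
  rw [singularHomology.map_comp]
  change IsIso ((singularHomology.mapIso ℤ ℤ (slitUVHomeomorph k) m).hom ≫
    (singularHomology.isoOfHomotopyEquiv ℤ ℤ (slitInterHomotopyEquiv k) m).hom)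
  infer_instance

/-- **Mayer–Vietoris step.** If the reflection in the `j`-th coordinate acts as the identity on
`Hₘ₊₁(ℝᵏ⁺¹ ∖ 0; ℤ)` (`m ≥ 1`), then it acts as the identity on `Hₘ(ℝᵏ ∖ 0; ℤ)`: the connecting
map `δ` of the slit decomposition is natural and surjective, and `A ∩ B ≃ₕ ℝᵏ ∖ 0` equivariantly
(Hatcher 2002, §2.2, pp. 149–150, and property (e) of the degree, p. 134).
[cite: HatcherAT2002, §2.2 pp. 149–150] -/
theorem map_reflPunctured_eq_id_of_succ (j : Fin k) {m : ℕ} (hm : m ≠ 0)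
    (h : singularHomology.map ℤ ℤ (reflPunctured (Fin.castSucc j)) (m + 1) = 𝟙 _) :
    singularHomology.map ℤ ℤ (reflPunctured j) m = 𝟙 (singularHomology ℤ ℤ ↥(punctured k) m) := by
  have hexc := relativeSingularHomology.isIso_map_of_interior_union_interior_holds ℤ ℤ
    ↥(punctured (k + 1))
  have hint := interior_slitU_union_interior_slitV k
  -- naturality of `δ` under the reflection
  have hnat := mayerVietoris.δ_naturality_holds ℤ ℤ hexc hexc (reflPunctured (Fin.castSucc j))
    (mapsTo_reflPunctured_slitU j) (mapsTo_reflPunctured_slitV j) hint hint m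
  rw [h, Category.id_comp] at hnat
  -- hence the reflection is the identity on `Hₘ(A ∩ B)` (`δ` is onto)
  have hUV : singularHomology.map ℤ ℤ (reflSlitUV j) m = 𝟙 _ := by
    ext β
    obtain ⟨α, rfl⟩ := slitδ_surjective k m hm β
    change (slitδ k m ≫ singularHomology.map ℤ ℤ (reflSlitUV j) m) α = slitδ k m α
    rw [hnat]
  -- transport along the equivariant homotopy equivalence `A ∩ B → ℝᵏ ∖ 0`
  have hcomp : singularHomology.map ℤ ℤ (slitUVProj k) m ≫
      singularHomology.map ℤ ℤ (reflPunctured j) m = singularHomology.map ℤ ℤ (slitUVProj k) m := by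
    rw [← singularHomology.map_comp, ← slitUVProj_comp_reflSlitUV, singularHomology.map_comp, hUV,
      Category.id_comp]
  rw [← cancel_epi (singularHomology.map ℤ ℤ (slitUVProj k) m), hcomp, Category.comp_id]

end MVStep

/-! ### The base case `H₁(ℝ² ∖ 0)` and the induction -/

section Base

/-- The point `(1, 0)` of the doubly slit plane `A ∩ B = {v | v₀ ≠ 0}`. [folklore] -/
def planePtPlus : ↥(slitU 1 ∩ slitV 1) :=
  ⟨⟨![1, 0], by simp [mem_punctured]⟩, by
    change (![1, 0] : RVec 2) ∈ slitUp 1 ∩ slitDown 1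
    rw [mem_slitInter_iff]
    intro h
    have := congrFun h 0
    simp [Fin.init] at this⟩

/-- The point `(-1, 0)` of the doubly slit plane. [folklore] -/
def planePtMinus : ↥(slitU 1 ∩ slitV 1) :=
  ⟨⟨![-1, 0], by simp [mem_punctured]⟩, by
    change (![-1, 0] : RVec 2) ∈ slitUp 1 ∩ slitDown 1
    rw [mem_slitInter_iff]
    intro h
    have := congrFun h 0
    simp [Fin.init] at this⟩

/-- The reflection `(x, y) ↦ (-x, y)` swaps `(1, 0)` and `(-1, 0)`. [folklore] -/
lemma reflSlitUV_planePtPlus : reflSlitUV (0 : Fin 1) planePtPlus = planePtMinus := by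
  apply Subtype.ext; apply Subtype.ext
  ext j
  fin_cases j <;> simp [planePtPlus, planePtMinus, negCoord_apply]

/-- The reflection `(x, y) ↦ (-x, y)` swaps `(-1, 0)` and `(1, 0)`. [folklore] -/
lemma reflSlitUV_planePtMinus : reflSlitUV (0 : Fin 1) planePtMinus = planePtPlus := by
  apply Subtype.ext; apply Subtype.ext
  ext j
  fin_cases j <;> simp [planePtPlus, planePtMinus, negCoord_apply]

/-- On the doubly slit plane `{v | v₀ ≠ 0}` the first coordinate does not vanish. [folklore] -/
lemma slitUV_coord_zero_ne_zero (v : ↥(slitU 1 ∩ slitV 1)) : v.1.1 0 ≠ 0 := by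
  intro h
  have hv : Fin.init v.1.1 ≠ 0 := (mem_slitInter_iff 1 v.1.1).1 v.2
  apply hv
  ext j
  fin_cases j
  simpa [Fin.init] using h

/-- The sign of the first coordinate, a continuous map from the doubly slit plane to the
two-point space (its two half planes). [folklore] -/
def planeSignMap : C(↥(slitU 1 ∩ slitV 1), PUnit.{1} ⊕ PUnit.{1}) where
  toFun v := if 0 < v.1.1 0 then Sum.inl PUnit.unit else Sum.inr PUnit.unit
  continuous_toFun := by
    have hc : Continuous fun v : ↥(slitU 1 ∩ slitV 1) => v.1.1 0 :=
      (continuous_apply 0).comp (continuous_subtype_val.comp continuous_subtype_val)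
    have hopen : IsOpen {v : ↥(slitU 1 ∩ slitV 1) | 0 < v.1.1 0} := isOpen_lt continuous_const hc
    have hclosed : IsClosed {v : ↥(slitU 1 ∩ slitV 1) | 0 < v.1.1 0} := by
      have : {v : ↥(slitU 1 ∩ slitV 1) | 0 < v.1.1 0} = {v | 0 ≤ v.1.1 0} := by
        ext v
        exact ⟨fun (h : 0 < v.1.1 0) => h.le,
          fun (h : 0 ≤ v.1.1 0) => lt_of_le_of_ne h (slitUV_coord_zero_ne_zero v).symm⟩
      rw [this]
      exact isClosed_le continuous_const hc
    refine continuous_if (fun a ha => ?_) continuousOn_const continuousOn_const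
    rw [(IsClopen.frontier_eq ⟨hclosed, hopen⟩)] at ha
    exact absurd ha (Set.notMem_empty a)

/-- `(1, 0)` lies in the right half plane. [folklore] -/
lemma planeSignMap_planePtPlus : planeSignMap planePtPlus = Sum.inl PUnit.unit := by
  simp [planeSignMap, planePtPlus]

/-- `(-1, 0)` lies in the left half plane. [folklore] -/
lemma planeSignMap_planePtMinus : planeSignMap planePtMinus = Sum.inr PUnit.unit := by
  simp [planeSignMap, planePtMinus]

/-- **Base case: the reflection `(x, y) ↦ (-x, y)` is not the identity on `H₁(ℝ² ∖ 0; ℤ)`**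
(Hatcher 2002, §2.2 property (e): a reflection has degree `-1`). Mayer–Vietoris: `δ` is natural
and, by exactness, hits `β₀ = [(1,0)] - [(-1,0)] ∈ H₀(A ∩ B)`, which the reflection negates while
`β₀ + β₀ ≠ 0`. [cite: HatcherAT2002, §2.2 property (e), p. 134] -/
theorem map_reflPunctured_one_ne_id :
    singularHomology.map ℤ ℤ (reflPunctured (Fin.castSucc (0 : Fin 1))) 1 ≠
      𝟙 (singularHomology ℤ ℤ ↥(punctured 2) 1) := by
  intro h
  have hexc := relativeSingularHomology.isIso_map_of_interior_union_interior_holds ℤ ℤ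
    ↥(punctured (1 + 1))
  have hint := interior_slitU_union_interior_slitV 1
  have hnat := mayerVietoris.δ_naturality_holds ℤ ℤ hexc hexc
    (reflPunctured (Fin.castSucc (0 : Fin 1))) (mapsTo_reflPunctured_slitU 0)
    (mapsTo_reflPunctured_slitV 0) hint hint 0
  rw [h, Category.id_comp] at hnat
  set β₀ : singularHomology ℤ ℤ ↥(slitU 1 ∩ slitV 1) 0 :=
    ptClass ptGen planePtPlus - ptClass ptGen planePtMinus with hβ₀
  -- `φ β₀ = 0`: both points lie in the path-connected pieces `A`, `B`
  have hφ : mayerVietoris.φ ℤ ℤ (slitU 1) (slitV 1) 0 β₀ = 0 := by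
    apply biprod_apply_ext
    · rw [mayerVietoris.φ, biprod_fst_lift_apply, map_zero]
      exact map_ptClass_sub_eq_zero _ (PathConnectedSpace.joined _ _)
    · rw [mayerVietoris.φ, biprod_snd_lift_apply, map_zero]
      change -(singularHomology.map ℤ ℤ (subsetInclusion Set.inter_subset_right) 0 β₀) = 0
      rw [neg_eq_zero]
      exact map_ptClass_sub_eq_zero _ (PathConnectedSpace.joined _ _)
  -- exactness: `β₀ = δ α`
  have hex := mayerVietoris.exact₃_holds ℤ ℤ (slitU 1) (slitV 1) hexc hint 0
  rw [ShortComplex.moduleCat_exact_iff] at hex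
  obtain ⟨α, hα⟩ := hex β₀ hφ
  -- so the reflection fixes `β₀`, contradicting the two-point lemma
  have hfix : singularHomology.map ℤ ℤ (reflSlitUV (0 : Fin 1)) 0 β₀ = β₀ := by
    rw [← hα]
    change (slitδ 1 0 ≫ singularHomology.map ℤ ℤ (reflSlitUV (0 : Fin 1)) 0) α = slitδ 1 0 α
    rw [hnat]
  exact map_ptClass_sub_ne_self (reflSlitUV (0 : Fin 1)) reflSlitUV_planePtPlus
    reflSlitUV_planePtMinus planeSignMap planeSignMap_planePtPlus planeSignMap_planePtMinus hfix

/-- **The reflection in the first coordinate is not the identity on `Hₘ₊₁(ℝᵐ⁺² ∖ 0; ℤ)`** for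
every `m` (Hatcher 2002, §2.2 property (e), p. 134: reflections have degree `-1` on `H̃ₙ(Sⁿ)`),
by induction along the Mayer–Vietoris steps down to `H₁(ℝ² ∖ 0)`.
[cite: HatcherAT2002, §2.2 property (e), p. 134] -/
theorem map_reflPunctured_zero_ne_id (m : ℕ) :
    singularHomology.map ℤ ℤ (reflPunctured (0 : Fin (m + 2))) (m + 1) ≠
      𝟙 (singularHomology ℤ ℤ ↥(punctured (m + 2)) (m + 1)) := by
  induction m with
  | zero =>
    have h := map_reflPunctured_one_ne_id
    rwa [Fin.castSucc_zero] at h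
  | succ m ih =>
    intro h
    apply ih
    have h' : singularHomology.map ℤ ℤ (reflPunctured (Fin.castSucc (0 : Fin (m + 2))))
        (m + 1 + 1) = 𝟙 _ := by
      rwa [Fin.castSucc_zero]
    exact map_reflPunctured_eq_id_of_succ (k := m + 2) 0 (m := m + 1) (by omega) h'

end Base


/-! ### Local homology of Euclidean space: the reflection is not the identity -/

section Euclidean

/-- Local notation: `𝔼 n` is the model Euclidean space `EuclideanSpace ℝ (Fin n)`. -/
local notation "𝔼 " n:arg => EuclideanSpace ℝ (Fin n)

/-- The reflection of `EuclideanSpace ℝ (Fin (n + 1))` in the first coordinate hyperplane,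
`(v₀, v₁, …) ↦ (-v₀, v₁, …)` (Hatcher 2002, §2.2 property (e)). [folklore] -/
def reflEuclidean (n : ℕ) : C(𝔼 (n + 1), 𝔼 (n + 1)) where
  toFun v := (coords (n + 1)).symm (negCoord 0 (coords (n + 1) v))
  continuous_toFun := (coords (n + 1)).symm.continuous.comp
    ((negCoord 0).continuous.comp (coords (n + 1)).continuous)

/-- The reflection in Euclidean coordinates (definition unfolded). [folklore] -/
lemma reflEuclidean_apply (n : ℕ) (v : 𝔼 (n + 1)) :
    reflEuclidean n v = (coords (n + 1)).symm (negCoord 0 (coords (n + 1) v)) := rfl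

/-- In sup-norm coordinates the reflection is `negCoord 0`. [folklore] -/
lemma coords_reflEuclidean (n : ℕ) (v : 𝔼 (n + 1)) :
    coords (n + 1) (reflEuclidean n v) = negCoord 0 (coords (n + 1) v) := by
  rw [reflEuclidean_apply, ContinuousLinearEquiv.apply_symm_apply]

/-- The reflection on coordinates: `(v₀, v₁, …) ↦ (-v₀, v₁, …)`. [folklore] -/
@[simp] lemma reflEuclidean_apply_apply (n : ℕ) (v : 𝔼 (n + 1)) (j : Fin (n + 1)) :
    reflEuclidean n v j = if j = 0 then -v j else v j :=
  congrFun (coords_reflEuclidean n v) j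

/-- Only the origin is reflected to the origin. [folklore] -/
lemma reflEuclidean_eq_zero_iff (n : ℕ) (v : 𝔼 (n + 1)) : reflEuclidean n v = 0 ↔ v = 0 := by
  rw [reflEuclidean_apply, (coords (n + 1)).symm.map_eq_zero_iff, negCoord_eq_zero_iff,
    (coords (n + 1)).map_eq_zero_iff]

/-- The reflection is a map of pairs `(ℝⁿ⁺¹, ℝⁿ⁺¹ ∖ 0) → (ℝⁿ⁺¹, ℝⁿ⁺¹ ∖ 0)`. [folklore] -/
lemma mapsTo_reflEuclidean (n : ℕ) :
    MapsTo (reflEuclidean n) ({0}ᶜ : Set (𝔼 (n + 1))) {0}ᶜ := fun v hv h =>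
  hv ((reflEuclidean_eq_zero_iff n v).1 h)

/-- `ℝⁿ⁺¹ ∖ {0} ≃ₜ punctured (n + 1)` (Euclidean versus sup-norm coordinates). [folklore] -/
def complZeroHomeomorph (n : ℕ) : ↥(({0}ᶜ : Set (𝔼 (n + 1)))) ≃ₜ ↥(punctured (n + 1)) where
  toFun v := ⟨coords (n + 1) v.1, fun h => v.2 ((coords (n + 1)).map_eq_zero_iff.1 h)⟩
  invFun w := ⟨(coords (n + 1)).symm w.1, fun h =>
    w.2 (((coords (n + 1)).symm.map_eq_zero_iff).1 h)⟩
  left_inv v := Subtype.ext ((coords (n + 1)).symm_apply_apply v.1)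
  right_inv w := Subtype.ext ((coords (n + 1)).apply_symm_apply w.1)
  continuous_toFun := ((coords (n + 1)).continuous.comp continuous_subtype_val).subtype_mk _
  continuous_invFun :=
    ((coords (n + 1)).symm.continuous.comp continuous_subtype_val).subtype_mk _

/-- The homeomorphism intertwines the reflections. [folklore] -/
lemma complZeroHomeomorph_comp_reflEuclidean (n : ℕ) :
    (complZeroHomeomorph n : C(↥(({0}ᶜ : Set (𝔼 (n + 1)))), ↥(punctured (n + 1)))).comp
        (subsetRestrict (reflEuclidean n) (mapsTo_reflEuclidean n)) =
      (reflPunctured 0).comp (complZeroHomeomorph n : C(_, ↥(punctured (n + 1)))) := by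
  ext v : 1
  apply Subtype.ext
  exact coords_reflEuclidean n v.1

/-- If the reflection is the identity on `Hₘ(ℝⁿ⁺¹ ∖ 0)` (as the subspace `{0}ᶜ`), it is the
identity on `Hₘ(punctured (n + 1))`. [folklore] -/
lemma map_reflPunctured_eq_id_of_complZero (n m : ℕ)
    (h : singularHomology.map ℤ ℤ
      (subsetRestrict (reflEuclidean n) (mapsTo_reflEuclidean n)) m = 𝟙 _) :
    singularHomology.map ℤ ℤ (reflPunctured (0 : Fin (n + 1))) m =
      𝟙 (singularHomology ℤ ℤ ↥(punctured (n + 1)) m) := by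
  have hcomp : (singularHomology.mapIso ℤ ℤ (complZeroHomeomorph n) m).hom ≫
      singularHomology.map ℤ ℤ (reflPunctured (0 : Fin (n + 1))) m =
      (singularHomology.mapIso ℤ ℤ (complZeroHomeomorph n) m).hom := by
    rw [singularHomology.mapIso_hom, ← singularHomology.map_comp,
      ← complZeroHomeomorph_comp_reflEuclidean, singularHomology.map_comp, h, Category.id_comp]
  rw [← cancel_epi (singularHomology.mapIso ℤ ℤ (complZeroHomeomorph n) m).hom, hcomp,
    Category.comp_id]

/-- The two points `±e₀` of `ℝ¹ ∖ 0`. [folklore] -/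
def axisPoint (s : ℝ) (hs : s ≠ 0) : ↥(({0}ᶜ : Set (𝔼 1))) :=
  ⟨(coords 1).symm ![s], fun h => by
    have := congrFun (congrArg (coords 1) (h : (coords 1).symm ![s] = 0)) 0
    simp at this
    exact hs this⟩

/-- The reflection of `ℝ¹` swaps `s e₀` and `-s e₀`. [folklore] -/
lemma reflEuclidean_axisPoint (s : ℝ) (hs : s ≠ 0) :
    subsetRestrict (reflEuclidean 0) (mapsTo_reflEuclidean 0) (axisPoint s hs) =
      axisPoint (-s) (neg_ne_zero.2 hs) := by
  apply Subtype.ext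
  change reflEuclidean 0 ((coords 1).symm ![s]) = (coords 1).symm ![-s]
  rw [reflEuclidean_apply, ContinuousLinearEquiv.apply_symm_apply]
  congr 1
  ext j
  fin_cases j
  simp

/-- The sign of the coordinate, a continuous map `ℝ¹ ∖ 0 → pt ⊔ pt`. [folklore] -/
def lineSignMap : C(↥(({0}ᶜ : Set (𝔼 1))), PUnit.{1} ⊕ PUnit.{1}) where
  toFun v := if 0 < v.1 0 then Sum.inl PUnit.unit else Sum.inr PUnit.unit
  continuous_toFun := by
    have hc : Continuous fun v : ↥(({0}ᶜ : Set (𝔼 1))) => v.1 0 :=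
      (PiLp.continuous_apply 2 _ 0).comp continuous_subtype_val
    have hne : ∀ v : ↥(({0}ᶜ : Set (𝔼 1))), v.1 0 ≠ 0 := by
      intro v h
      apply v.2
      change v.1 = 0
      ext j
      fin_cases j
      simpa using h
    have hopen : IsOpen {v : ↥(({0}ᶜ : Set (𝔼 1))) | 0 < v.1 0} := isOpen_lt continuous_const hc
    have hclosed : IsClosed {v : ↥(({0}ᶜ : Set (𝔼 1))) | 0 < v.1 0} := by
      have : {v : ↥(({0}ᶜ : Set (𝔼 1))) | 0 < v.1 0} = {v | 0 ≤ v.1 0} := by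
        ext v
        exact ⟨fun (h : 0 < v.1 0) => h.le,
          fun (h : 0 ≤ v.1 0) => lt_of_le_of_ne h (hne v).symm⟩
      rw [this]
      exact isClosed_le continuous_const hc
    refine continuous_if (fun a ha => ?_) continuousOn_const continuousOn_const
    rw [(IsClopen.frontier_eq ⟨hclosed, hopen⟩)] at ha
    exact absurd ha (Set.notMem_empty a)

/-- The sign of `s e₀` is the sign of `s`. [folklore] -/
lemma lineSignMap_axisPoint (s : ℝ) (hs : s ≠ 0) :
    lineSignMap (axisPoint s hs) = if 0 < s then Sum.inl PUnit.unit else Sum.inr PUnit.unit := by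
  simp [lineSignMap, axisPoint]

/-- **A reflection is not the identity on the local homology `Hₙ₊₁(ℝⁿ⁺¹ | 0; ℤ)`** (Hatcher 2002,
§3.3, p. 233: "a reflection takes `α` to `-α`"; §2.2 Exercise 7). Through the connecting map of
the pair `(ℝⁿ⁺¹, ℝⁿ⁺¹ ∖ 0)` (natural, and onto `Hₙ(ℝⁿ⁺¹ ∖ 0)` for `n ≥ 1` since `ℝⁿ⁺¹` is
contractible) this is
`Literature.AlgebraicTopology.SingularHomology.map_reflPunctured_zero_ne_id`; for
`n = 0` the two-point lemma is applied to `H₀(ℝ ∖ 0)` directly.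
[cite: HatcherAT2002, §3.3 p. 233] -/
theorem localHomology_map_reflEuclidean_ne_id (n : ℕ) :
    relativeSingularHomology.map ℤ ℤ (reflEuclidean n) (mapsTo_reflEuclidean n) (n + 1) ≠
      𝟙 (localHomology ℤ ℤ (𝔼 (n + 1)) 0 (n + 1)) := by
  intro h
  have hnat :=
    relativeSingularHomology.δ_naturality ℤ ℤ (reflEuclidean n) (mapsTo_reflEuclidean n) n
  rw [h, Category.id_comp] at hnat
  cases n with
  | zero =>
    -- `β₀ = [e₀] - [-e₀] ∈ H₀(ℝ ∖ 0)` dies in `H₀(ℝ)`, hence lies in the image of `δ`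
    set β₀ : singularHomology ℤ ℤ ↥(({0}ᶜ : Set (𝔼 1))) 0 :=
      ptClass ptGen (axisPoint 1 one_ne_zero) -
        ptClass ptGen (axisPoint (-1) (neg_ne_zero.2 one_ne_zero))
      with hβ₀
    have hi : singularHomology.map ℤ ℤ
        (⟨Subtype.val, continuous_subtype_val⟩ : C(↥(({0}ᶜ : Set (𝔼 1))), 𝔼 1)) 0 β₀ = 0 :=
      map_ptClass_sub_eq_zero _ (PathConnectedSpace.joined _ _)
    have hex := relativeSingularHomology.exact_δ_map ℤ ℤ ({0}ᶜ : Set (𝔼 1)) 0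
    rw [ShortComplex.moduleCat_exact_iff] at hex
    obtain ⟨α, hα⟩ := hex β₀ hi
    have hfix : singularHomology.map ℤ ℤ
        (subsetRestrict (reflEuclidean 0) (mapsTo_reflEuclidean 0)) 0 β₀ = β₀ := by
      rw [← hα]
      change (relativeSingularHomology.δ ℤ ℤ (𝔼 1) {0}ᶜ 0 ≫
        singularHomology.map ℤ ℤ
          (subsetRestrict (reflEuclidean 0) (mapsTo_reflEuclidean 0)) 0) α = _
      rw [hnat]
    refine map_ptClass_sub_ne_self (subsetRestrict (reflEuclidean 0) (mapsTo_reflEuclidean 0))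
      ?_ ?_ lineSignMap ?_ ?_ hfix
    · rw [reflEuclidean_axisPoint]
    · rw [reflEuclidean_axisPoint]; congr 1; norm_num
    · rw [lineSignMap_axisPoint, if_pos one_pos]
    · rw [lineSignMap_axisPoint, if_neg (by norm_num)]
  | succ n =>
    -- `δ : Hₙ₊₂(ℝⁿ⁺² | 0) → Hₙ₊₁(ℝⁿ⁺² ∖ 0)` is onto, so the reflection is the identity downstairs
    have hsurj : Function.Surjective
        (relativeSingularHomology.δ ℤ ℤ (𝔼 (n + 2)) ({0}ᶜ : Set (𝔼 (n + 2))) (n + 1)) := by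
      intro β
      have hex := relativeSingularHomology.exact_δ_map ℤ ℤ ({0}ᶜ : Set (𝔼 (n + 2))) (n + 1)
      rw [ShortComplex.moduleCat_exact_iff] at hex
      have hZ : IsZero (singularHomology ℤ ℤ (𝔼 (n + 2)) (n + 1)) :=
        isZero_singularHomology_of_contractibleSpace ℤ ℤ (Nat.succ_ne_zero n)
      haveI := ModuleCat.subsingleton_of_isZero hZ
      obtain ⟨α, hα⟩ := hex β (Subsingleton.elim _ _)
      exact ⟨α, hα⟩
    have hA : singularHomology.map ℤ ℤ
        (subsetRestrict (reflEuclidean (n + 1)) (mapsTo_reflEuclidean (n + 1))) (n + 1) = 𝟙 _ := by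
      ext β
      obtain ⟨α, rfl⟩ := hsurj β
      change (relativeSingularHomology.δ ℤ ℤ (𝔼 (n + 2)) {0}ᶜ (n + 1) ≫
        singularHomology.map ℤ ℤ
          (subsetRestrict (reflEuclidean (n + 1)) (mapsTo_reflEuclidean (n + 1))) (n + 1)) α = _
      rw [hnat]
      rfl
    exact map_reflPunctured_zero_ne_id n (map_reflPunctured_eq_id_of_complZero (n + 1) (n + 1) hA)

end Euclidean

end Literature.AlgebraicTopology.SingularHomology
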